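import Summits.CriticalPhenomena.PercolationContinuityZ3.Theorems.Transplant.FKConnectivityAllQAntipodalRootFormRealDefs
import Summits.CriticalPhenomena.PercolationContinuityZ3.Theorems.Transplant.FKConnectivityAllQAntipodalRootFormGen

/-!
# Connectivity correlation inequalities for `φ_{w,q}`, every `q > 0` — ROOT-FORM CALCULUS, file 74a (DEFINITIONS): the REAL THREE-SPECIAL
# environment (`T2⁺` pipeline, real side)

Definitions file (`--supports stmt-CriticalPhenomena-4575`), FK sub-lane `prim-bschramm-fk-2` (gen 32); builds on p205010 (kernel theorem,
internal audit signed; external expert review pending).  No named facts, no sorries.  Memo FROM-fk-2-g31-DUALITY.md §6 (G4), FROM-fk-2-g32-*.md.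

File 61k (`FK.RootForm.realEnv`) realises the abstract two-special environment of file 61a in the tree's vocabulary; the generic engine of
files 61α–61η (`FK.RootForm.Gen.*`) treats environments whose specials are indexed by a finite type `ι`, the pattern data being indexed by
`Finset ι` (the specials placed in replica 1).  This file realises the generic environment for THREE special edges `y, z, w` (indices
`0, 1, 2 : Fin 3`, the convention of `FK.RootForm.Base3.gcombPar`, file 73a) of an edge set with poles `a, b` and cell `M` (free) / `C`
(contracted): `realEnv3 M C a b y z w : Gen.Env (Fin 3) ↥M.powerset`, configuration `β ⊆ M` and pattern `P ⊆ {0,1,2}` ↦ the datum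
`realPDat (insert w M) C a b y z (patSet3 y z w P β)` — level `apExpC (M ∪ {y,z,w}) C` and the two pole bits of the replica-1 edge set
`patSet3 y z w P β = β ∪ {the specials indexed by P}` (written as a chain of conditional insertions `insIf`, so that for an explicit pattern it
is an explicit `insert`-chain: `patSet3_table`).  The bookkeeping lemmas (`mem_patSet3`, `patSet3_subset`, `union_patSet3`,
`compl_patSet3`) are the only interface used by the proof files 74b–74g.
[cite: Grimmett2006, §1.4 eq. (1.20) (p. 15); §3.8 (pp. 61–62)]
-/

noncomputable section

namespace Summit.CriticalPhenomena.PercolationContinuityZ3.Theorems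

namespace FK

namespace RootForm

open Literature.Probability.LatticeModels Literature.Probability.Percolation
open scoped Classical

variable {V : Type*}

/-- conditional insertion: `insIf p e X = insert e X` if `p`, else `X`. [folklore] -/
def insIf (p : Prop) [Decidable p] (e : Sym2 V) (X : Finset (Sym2 V)) : Finset (Sym2 V) := if p then insert e X else X

/-- The replica-1 edge set of the three-special pattern `P ⊆ {0,1,2}` (`0 = y`, `1 = z`, `2 = w`) over the free configuration `X`:
`X ∪ {specials indexed by P}`. [folklore] -/
def patSet3 (y z w : Sym2 V) (P : Finset (Fin 3)) (X : Finset (Sym2 V)) : Finset (Sym2 V) :=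
  insIf ((0 : Fin 3) ∈ P) y (insIf ((1 : Fin 3) ∈ P) z (insIf ((2 : Fin 3) ∈ P) w X))

/-- **The real three-special environment** of an edge set with poles `a, b`, special edges `y, z, w` (indices `0, 1, 2`), cell `M` free /
`C` contracted (inside the edge set, off `y, z, w`): configuration `β ⊆ M` and pattern `P` ↦ the level `apExpC (M ∪ {y,z,w}) C` and the pole
bits of the two replicas of the replica-1 edge set `patSet3 y z w P β` — the `FK.RootForm.Gen.Env (Fin 3)` of file 61α realised in the
tree's vocabulary (via `FK.RootForm.realPDat` of file 61k with `w` moved into the free cell).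
[cite: Grimmett2006, §1.4 eq. (1.20) (p. 15); §3.8 (pp. 61–62)] -/
def realEnv3 [Fintype V] (M C : Finset (Sym2 V)) (a b : V) (y z w : Sym2 V) : Gen.Env (Fin 3) ↥M.powerset := fun β =>
  ⟨fun P => realPDat (insert w M) C a b y z (patSet3 y z w P β.1)⟩

section Bookkeeping

variable (y z w : Sym2 V)

/-- the pattern datum of the real three-special environment. [folklore] -/
theorem realEnv3_d [Fintype V] (M C : Finset (Sym2 V)) (a b : V) (β : ↥M.powerset) (P : Finset (Fin 3)) :
    (realEnv3 M C a b y z w β).d P = realPDat (insert w M) C a b y z (patSet3 y z w P β.1) := rfl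

/-- `insIf` unfolded. [folklore] -/
theorem insIf_pos {p : Prop} [Decidable p] (hp : p) (e : Sym2 V) (X : Finset (Sym2 V)) : insIf p e X = insert e X := if_pos hp
/-- `insIf` unfolded. [folklore] -/
theorem insIf_neg {p : Prop} [Decidable p] (hp : ¬p) (e : Sym2 V) (X : Finset (Sym2 V)) : insIf p e X = X := if_neg hp
/-- membership in `insIf`. [folklore] -/
theorem mem_insIf {p : Prop} [Decidable p] {e f : Sym2 V} {X : Finset (Sym2 V)} : f ∈ insIf p e X ↔ (p ∧ f = e) ∨ f ∈ X := by
  unfold insIf; split_ifs with h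
  · rw [Finset.mem_insert]; simp only [h, true_and]
  · simp only [h, false_and, false_or]
/-- `insIf` commutes with unions on the left. [folklore] -/
theorem union_insIf {p : Prop} [Decidable p] (e : Sym2 V) (A X : Finset (Sym2 V)) : A ∪ insIf p e X = insIf p e (A ∪ X) := by
  unfold insIf; split_ifs
  · exact Finset.union_insert _ _ _
  · rfl

/-- **The eight patterns written out.** [folklore] -/
theorem patSet3_table (X : Finset (Sym2 V)) :
    patSet3 y z w ∅ X = X ∧ patSet3 y z w {0} X = insert y X ∧ patSet3 y z w {1} X = insert z X ∧ patSet3 y z w {2} X = insert w X ∧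
    patSet3 y z w {0, 1} X = insert y (insert z X) ∧ patSet3 y z w {0, 2} X = insert y (insert w X) ∧
    patSet3 y z w {1, 2} X = insert z (insert w X) ∧ patSet3 y z w Finset.univ X = insert y (insert z (insert w X)) := by
  simp only [patSet3]
  refine ⟨?_, ?_, ?_, ?_, ?_, ?_, ?_, ?_⟩
  · rw [insIf_neg (by decide), insIf_neg (by decide), insIf_neg (by decide)]
  · rw [insIf_pos (by decide), insIf_neg (by decide), insIf_neg (by decide)]
  · rw [insIf_neg (by decide), insIf_pos (by decide), insIf_neg (by decide)]
  · rw [insIf_neg (by decide), insIf_neg (by decide), insIf_pos (by decide)]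
  · rw [insIf_pos (by decide), insIf_pos (by decide), insIf_neg (by decide)]
  · rw [insIf_pos (by decide), insIf_neg (by decide), insIf_pos (by decide)]
  · rw [insIf_neg (by decide), insIf_pos (by decide), insIf_pos (by decide)]
  · rw [insIf_pos (by decide), insIf_pos (by decide), insIf_pos (by decide)]

/-- membership in a pattern set. [folklore] -/
theorem mem_patSet3 {P : Finset (Fin 3)} {X : Finset (Sym2 V)} {e : Sym2 V} :
    e ∈ patSet3 y z w P X ↔ ((0 : Fin 3) ∈ P ∧ e = y) ∨ ((1 : Fin 3) ∈ P ∧ e = z) ∨ ((2 : Fin 3) ∈ P ∧ e = w) ∨ e ∈ X := by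
  simp only [patSet3, mem_insIf]

/-- the free configuration lies in every pattern set. [folklore] -/
theorem subset_patSet3 (P : Finset (Fin 3)) (X : Finset (Sym2 V)) : X ⊆ patSet3 y z w P X := fun _ he =>
  (mem_patSet3 y z w).2 (Or.inr (Or.inr (Or.inr he)))

/-- pattern sets stay inside `M ∪ {y,z,w}`. [folklore] -/
theorem patSet3_subset (P : Finset (Fin 3)) {X M : Finset (Sym2 V)} (hX : X ⊆ M) :
    patSet3 y z w P X ⊆ insert y (insert z (insert w M)) := by
  intro e he
  rw [mem_patSet3] at he
  rw [Finset.mem_insert, Finset.mem_insert, Finset.mem_insert]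
  rcases he with ⟨_, rfl⟩ | ⟨_, rfl⟩ | ⟨_, rfl⟩ | h
  · exact Or.inl rfl
  · exact Or.inr (Or.inl rfl)
  · exact Or.inr (Or.inr (Or.inl rfl))
  · exact Or.inr (Or.inr (Or.inr (hX h)))

/-- pattern sets are monotone in the free configuration. [folklore] -/
theorem patSet3_mono (P : Finset (Fin 3)) {X X' : Finset (Sym2 V)} (h : X ⊆ X') : patSet3 y z w P X ⊆ patSet3 y z w P X' := by
  intro e he
  rw [mem_patSet3] at he ⊢
  rcases he with he | he | he | he
  · exact Or.inl he
  · exact Or.inr (Or.inl he)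
  · exact Or.inr (Or.inr (Or.inl he))
  · exact Or.inr (Or.inr (Or.inr (h he)))

/-- **Unions pass inside a pattern set** (gluing of configurations). [folklore] -/
theorem union_patSet3 (P : Finset (Fin 3)) (A X : Finset (Sym2 V)) : A ∪ patSet3 y z w P X = patSet3 y z w P (A ∪ X) := by
  simp only [patSet3, union_insIf]

/-- **The antipodal pattern set**: the complement of the pattern set of `(P, X)` inside `M ∪ {y,z,w}` is the pattern set of `(Pᶜ, M \ X)`
(`y, z, w ∉ M` pairwise distinct, `X ⊆ M`). [folklore] -/
theorem compl_patSet3 {M X : Finset (Sym2 V)} (hyM : y ∉ M) (hzM : z ∉ M) (hwM : w ∉ M) (hyz : y ≠ z) (hyw : y ≠ w) (hzw : z ≠ w)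
    (hX : X ⊆ M) (P : Finset (Fin 3)) :
    insert y (insert z (insert w M)) \ patSet3 y z w P X = patSet3 y z w Pᶜ (M \ X) := by
  ext e
  rw [Finset.mem_sdiff, mem_patSet3, mem_patSet3, Finset.mem_insert, Finset.mem_insert, Finset.mem_insert, Finset.mem_sdiff,
    Finset.mem_compl, Finset.mem_compl, Finset.mem_compl]
  constructor
  · rintro ⟨h1, h2⟩
    rcases h1 with rfl | rfl | rfl | heM
    · refine Or.inl ⟨fun h0 => h2 (Or.inl ⟨h0, rfl⟩), rfl⟩
    · refine Or.inr (Or.inl ⟨fun h0 => h2 (Or.inr (Or.inl ⟨h0, rfl⟩)), rfl⟩)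
    · refine Or.inr (Or.inr (Or.inl ⟨fun h0 => h2 (Or.inr (Or.inr (Or.inl ⟨h0, rfl⟩))), rfl⟩))
    · exact Or.inr (Or.inr (Or.inr ⟨heM, fun heX => h2 (Or.inr (Or.inr (Or.inr heX)))⟩))
  · rintro (⟨h0, rfl⟩ | ⟨h0, rfl⟩ | ⟨h0, rfl⟩ | ⟨heM, heX⟩)
    · refine ⟨Or.inl rfl, ?_⟩
      rintro (⟨h, _⟩ | ⟨_, h⟩ | ⟨_, h⟩ | h)
      · exact h0 h
      · exact hyz h
      · exact hyw h
      · exact hyM (hX h)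
    · refine ⟨Or.inr (Or.inl rfl), ?_⟩
      rintro (⟨_, h⟩ | ⟨h, _⟩ | ⟨_, h⟩ | h)
      · exact hyz h.symm
      · exact h0 h
      · exact hzw h
      · exact hzM (hX h)
    · refine ⟨Or.inr (Or.inr (Or.inl rfl)), ?_⟩
      rintro (⟨_, h⟩ | ⟨_, h⟩ | ⟨h, _⟩ | h)
      · exact hyw h.symm
      · exact hzw h.symm
      · exact h0 h
      · exact hwM (hX h)
    · refine ⟨Or.inr (Or.inr (Or.inr heM)), ?_⟩
      rintro (⟨_, rfl⟩ | ⟨_, rfl⟩ | ⟨_, rfl⟩ | h)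
      · exact hyM heM
      · exact hzM heM
      · exact hwM heM
      · exact heX h

end Bookkeeping

end RootForm

end FK

end Summit.CriticalPhenomena.PercolationContinuityZ3.Theorems

end
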